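import Literature.AlgebraicGeometry.Resolution.KawasakiBlowupInduction
import HarnessLib

/-!
# Kawasaki's blow-up: peeling off a regular sequence of `M/(x)M` (Česnavičius's reduction)

Topic: `Literature/AlgebraicGeometry/Resolution`. `AdmChart.cechVanishBelow`
(`KawasakiBlowupInduction.lean`) bounds the depth of the chart modules of Kawasaki's blow-up
`Bl_I(M)`, `I = ∏_{t<e}(x_{t+1},…,x_e)` for a `p`-standard sequence `xs = x_1,…,x_e` of `M`,
from below by `e = |xs|` at the closed points. When `xs` is only PART of a system of parameters
and `M/(xs)M` is Cohen–Macaulay — Kawasaki 2000, Thm. 4.1 "furthermore" / Cor. 4.2 with `t > 1`,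
Česnavičius 2021, Thm. 3.13 in the generality of its proof ("we only require that each initial
subsequence satisfy (KI-a,b,c) and that `M/(r_1,…,r_m)M` be Cohen–Macaulay") — the bound
improves by the length of an `M/(xs)M`-regular sequence `zs ⊆ 𝔪`: by (KI-a) each `z` is regular
on the chart modules with quotient the chart module of `M/zM` (Česnavičius: "`r'` is
`(⊕ IⁿM)`-regular with `(⊕ IⁿM)/r'(⊕ IⁿM) ≅ ⊕ Iⁿ(M/r'M)` … we may replace `M` by `M/r'M`"),
so the local cohomology vanishing climbs by one at each step
(`AdmChart.cechVanishBelow_of_isWeaklyRegular`).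

Everything is proved; no named facts.

## References

* [Cesnavicius2021] K. Česnavičius, *Macaulayfication of Noetherian schemes*, Duke Math. J. 170
  (2021), proof of Thm. 3.13 (the reduction to `M/(r_1,…,r_m)M` zero-dimensional).
* [Kawasaki2000] T. Kawasaki, *On Macaulayfication of Noetherian schemes*, Trans. AMS 352 (2000),
  Thm. 4.1 (the case `M/q_t M` Cohen–Macaulay), Cor. 4.2.
-/

noncomputable section

open IsLocalization Pointwise Ideal IsLocalRing RingTheory.Sequence
  Literature.RingTheory.LocalCohomology

namespace Literature.AlgebraicGeometry.Resolution

universe u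

variable {R : Type u} [CommRing R]

/-! ## Scalars and quotients -/

/-- `(algebraMap z) • P = z • P` for submodules over `R[I/g]`. [folklore] -/
theorem algebraMap_smul_submodule_eq {I : Ideal R} {g : R} {N : Type u} [AddCommGroup N]
    [Module (blowupAlgebra I g) N] [Module R N] [IsScalarTower R (blowupAlgebra I g) N]
    (z : R) (P : Submodule (blowupAlgebra I g) N) :
    algebraMap R (blowupAlgebra I g) z • P = z • P := by
  ext n
  simp only [Submodule.mem_smul_pointwise_iff_exists, algebraMap_smul]

variable [IsLocalRing R] [IsNoetherianRing R]
variable {M : Type u} [AddCommGroup M] [Module R M] [Module.Finite R M]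
variable {xs : List R}

/-- **`(M/(Y)M)/z ≅ M/(Y, z)M` inside the `(Y) + (xs)` bookkeeping**:
`(M/((Y)M + (xs)M)) / z ≅ M/((Y,z)M + (xs)M)`. [folklore] -/
def quotSupQuotEquiv (Y : List R) (z : R) (K : Submodule R M) :
    QuotSMulTop z (M ⧸ (ofList Y • ⊤ ⊔ K : Submodule R M)) ≃ₗ[R]
      M ⧸ (ofList (Y ++ [z]) • ⊤ ⊔ K : Submodule R M) :=
  Submodule.quotEquivOfEq _ _ (by
    rw [Submodule.map_pointwise_smul, Submodule.map_top, Submodule.range_mkQ]) ≪≫ₗ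
  Submodule.quotientQuotientEquivQuotientSup (ofList Y • ⊤ ⊔ K : Submodule R M) (z • ⊤) ≪≫ₗ
  Submodule.quotEquivOfEq _ _ (by
    rw [ofList_append, ofList_singleton, Submodule.sup_smul, Submodule.ideal_span_singleton_smul,
      sup_right_comm])

omit [IsLocalRing R] [IsNoetherianRing R] [Module.Finite R M] in
/-- **(KI-a) on `M̄ = M/(Y)M`, quotient form**: if `z` is `M/((Y)M + IⁿM)`-regular then
`z m̄ ∈ Iⁿ M̄` implies `m̄ ∈ Iⁿ M̄`. [cite: Cesnavicius2021, Prop. 3.10 (a)] -/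
theorem mem_pow_smul_top_of_isSMulRegular {Y : List R} {z : R} {I : Ideal R} {n : ℕ}
    (h : IsSMulRegular (M ⧸ (ofList Y • ⊤ ⊔ I ^ n • ⊤ : Submodule R M)) z)
    (m' : M ⧸ (ofList Y • ⊤ : Submodule R M))
    (hm' : z • m' ∈ I ^ n • (⊤ : Submodule R (M ⧸ (ofList Y • ⊤ : Submodule R M)))) :
    m' ∈ I ^ n • (⊤ : Submodule R (M ⧸ (ofList Y • ⊤ : Submodule R M))) := by
  induction m' using Submodule.Quotient.induction_on with | _ m =>
  rw [← Submodule.Quotient.mk_smul, ← Submodule.mkQ_apply, mkQ_mem_smul_top_iff] at hm'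
  rw [← Submodule.mkQ_apply, mkQ_mem_smul_top_iff]
  rw [← Submodule.Quotient.mk_eq_zero, Submodule.Quotient.mk_smul] at hm'
  rw [← Submodule.Quotient.mk_eq_zero]
  exact h (show z • Submodule.Quotient.mk m = z • (0 : M ⧸ (ofList Y • ⊤ ⊔ I ^ n • ⊤ :
    Submodule R M)) by rw [hm', smul_zero])

/-- **Peeling** (Česnavičius 2021, proof of Thm. 3.13; Kawasaki 2000, Thm. 4.1 "furthermore"):
for a `p`-standard sequence `xs` of `M`, lists `Y, Z ⊆ 𝔪` with `xs, Y, Z` a subsystem of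
parameters of `M` and `Z` weakly regular on `M/((Y)M + (xs)M)`, the chart modules of
`M̄ = M/(Y)M` on the recursive charts of `Bl_{I_0}` have `Hʲ_𝔔 = 0` for `j < |xs| + |Z|` at every
maximal `𝔔 ⊇ 𝔪`. [cite: Cesnavicius2021, Thm. 3.13 (proof)] [cite: Kawasaki2000, Thm. 4.1] -/
theorem AdmChart.cechVanishBelow_of_isWeaklyRegular (hx : IsPStandard M xs) {g c : R}
    (hch : AdmChart xs 0 g c) {Z : List R} :
    ∀ {Y : List R}, IsSecantSequence M (xs ++ (Y ++ Z)) → (∀ y ∈ Y ++ Z, y ∈ maximalIdeal R) →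
      IsWeaklyRegular (M ⧸ (ofList Y • ⊤ ⊔ ofList xs • ⊤ : Submodule R M)) Z →
      ∀ (𝔔 : Ideal (blowupAlgebra (kCentre xs 0) g)), 𝔔.IsMaximal →
        (maximalIdeal R).map (algebraMap R _) ≤ 𝔔 →
        ∀ {t : ℕ} {y : Fin t → blowupAlgebra (kCentre xs 0) g}, Ideal.span (Set.range y) = 𝔔 →
          CechVanishBelow y (chartModule (kCentre xs 0) g (M ⧸ (ofList Y • ⊤ : Submodule R M)))
            (xs.length + Z.length) := by
  induction Z with
  | nil =>
    intro Y hsec hym _ 𝔔 h𝔔 h𝔔m t y hy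
    rw [List.length_nil, Nat.add_zero, ← Nat.sub_zero xs.length]
    rw [List.append_nil] at hsec hym
    exact hch.cechVanishBelow hx (by rwa [List.drop_zero]) hym 𝔔 h𝔔 h𝔔m hy
  | cons z Z ih =>
    intro Y hsec hym hreg 𝔔 h𝔔 h𝔔m t y hy
    have hd : 0 < xs.length := hch.lt
    have hg : g ∈ kCentre xs 0 := hch.mem_kCentre
    rw [isWeaklyRegular_cons_iff] at hreg
    obtain ⟨hz, hZ⟩ := hreg
    have hmem : ∀ r ∈ xs ++ (Y ++ z :: Z), r ∈ maximalIdeal R := fun r hr => by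
      rcases List.mem_append.mp hr with h | h
      · exact hx.mem_maximalIdeal r h
      · exact hym r h
    -- (KI-a): `z` is regular on `M̄ = M/(Y)M` and on `M̄/IⁿM̄`
    have hsecYz : IsSecantSequence M (xs.drop 0 ++ (Y ++ [z])) := by
      rw [List.drop_zero]
      exact hsec.sublist (((List.sublist_append_left [z] Z).append_left Y).append_left xs) hmem
    have hymz : ∀ r ∈ Y ++ [z], r ∈ maximalIdeal R := fun r hr => by
      rcases List.mem_append.mp hr with h | h
      · exact hym r (List.mem_append_left _ h)
      · rw [List.mem_singleton.mp h]; exact hym z (List.mem_append_right _ List.mem_cons_self)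
    have hKIa := fun n (hn : 0 < n) => hx.kawasakiInput_a_isSMulRegular hd hsecYz hymz
      (by rwa [tailIdeal, List.drop_zero]) hn
    have hzM : IsSMulRegular (M ⧸ (ofList Y • ⊤ : Submodule R M)) z := (hKIa 1 one_pos).1
    have hzI : ∀ n, 1 ≤ n → ∀ m' : M ⧸ (ofList Y • ⊤ : Submodule R M),
        z • m' ∈ kCentre xs 0 ^ n • (⊤ : Submodule R (M ⧸ (ofList Y • ⊤ : Submodule R M))) →
          m' ∈ kCentre xs 0 ^ n • (⊤ : Submodule R (M ⧸ (ofList Y • ⊤ : Submodule R M))) := by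
      intro n hn m' hm'
      have h2 := (hKIa n hn).2
      rw [prodPow_const] at h2
      exact mem_pow_smul_top_of_isSMulRegular h2 m' hm'
    -- `z` on the chart module `N = M̄_{(g)}`: regular, with `N/zN ≅ (M̄/zM̄)_{(g)} ≅ (M/(Y,z)M)_{(g)}`
    have hzN : IsSMulRegular (chartModule (kCentre xs 0) g (M ⧸ (ofList Y • ⊤ : Submodule R M)))
        (algebraMap R (blowupAlgebra (kCentre xs 0) g) z) :=
      (isSMulRegular_algebraMap_iff _ g z).mpr
        (chartModule.isSMulRegular_of_forall_pow _ g hg fun n _ m _ h0 =>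
          hzM (show z • m = z • (0 : M ⧸ (ofList Y • ⊤ : Submodule R M)) by rw [h0, smul_zero]))
    have hker := chartModule.ker_chartModuleMap_mkQ_eq_smul (kCentre xs 0) g
      (E := M ⧸ (ofList Y • ⊤ : Submodule R M)) hg hzI
    have hzrad : algebraMap R (blowupAlgebra (kCentre xs 0) g) z ∈
        (Ideal.span (Set.range y)).radical :=
      Ideal.le_radical (by
        rw [hy]; exact h𝔔m (Ideal.mem_map_of_mem _ (hym z (List.mem_append_right _
          List.mem_cons_self))))
    -- induction hypothesis for `Y ++ [z]`
    have hsec' : IsSecantSequence M (xs ++ ((Y ++ [z]) ++ Z)) := by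
      rwa [List.append_assoc, List.singleton_append]
    have hym' : ∀ r ∈ (Y ++ [z]) ++ Z, r ∈ maximalIdeal R := fun r hr => hym r (by
      rwa [List.append_assoc, List.singleton_append] at hr)
    have hreg' : IsWeaklyRegular
        (M ⧸ (ofList (Y ++ [z]) • ⊤ ⊔ ofList xs • ⊤ : Submodule R M)) Z :=
      (LinearEquiv.isWeaklyRegular_congr (quotSupQuotEquiv Y z (ofList xs • ⊤)) Z).mp hZ
    have IH := ih hsec' hym' hreg' 𝔔 h𝔔 h𝔔m hy
    -- climb by one
    rw [List.length_cons, ← Nat.add_assoc]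
    refine CechVanishBelow.of_quotSMulTop_of_eq hzN hzrad
      (P := LinearMap.ker (chartModuleMap (kCentre xs 0) g
        ((z • (⊤ : Submodule R (M ⧸ (ofList Y • ⊤ : Submodule R M)))).mkQ)))
      (by rw [hker, algebraMap_smul_submodule_eq]) ?_
    exact IH.of_equiv ((chartModuleQuotKerEquiv (kCentre xs 0) g _
      (Submodule.mkQ_surjective _)).trans (chartModuleCongr (kCentre xs 0) g
        (quotQuotEquiv Y z))).symm

end Literature.AlgebraicGeometry.Resolution

end
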